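import Literature.Geometry.ComplexAnalytic.RelativeExponentialChartReframe
import Literature.Geometry.ComplexAnalytic.RelativeExponentialUniformisation
import Literature.AlgebraicGeometry.ModuliOfAbelianVarieties.SiegelModuliInterpretation
import Literature.Geometry.Kaehler.ComplexTorusSiegelNormalForm
import Literature.NumberTheory.Transcendental.AnalytificationUniquenessProofs
import Literature.NumberTheory.Transcendental.AbelianVarietyAnalyticLieGroup
import Literature.AlgebraicGeometry.Motives.AbelianVarietyProofs
import HarnessLib

/-!
# NORM₀ «NORMALISING A RELATIVE EXPONENTIAL CHART AT A POINT»: a chart of `A^an → T^an` is re-framed so that its fibre map at `t₀` IS a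
# prescribed analytification of the fibre `A_{t₀}` (e.g. an admissible marking), by a CONSTANT change of frame
# ([LangeBirkenhake1992] §1.1.2 Prop. 1.1.6; [SerreGAGA1956] §2 n°5 Prop. 2; [BirkenhakeLange2004] §8.7)

Topic `Literature/AlgebraicGeometry/ModuliOfAbelianVarieties`; namespace `Literature.AlgebraicGeometry.ModuliOfAbelianVarieties`.
THEOREMS ONLY (no definition, no named fact, no instance, no notation, no `sorry`).  Cell `hodgecm-mathlib` (D-0151), FLOOR 0, P6 «MOD»
(crux hLiu418 = stmt-HodgeConjecture-24832, `--supports`), half A line L7 (socket `stub_UNIVFAM` = ★ P-3 `siegelUniversalFamilyUniformisation`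
→ in-house), sub-organ **FLAT-a «NORM₀»** of the heart `stub_FLAT` (LA7-p01 (g0) census 02:19:21Z; LA7-plan (g0) skeleton v1 87d1e7d53ea8d160).
Over ★ REFRAME `IsRelExpChartOn.reframe` (p847723), ★ GAGA uniqueness `IsAnalytification.unique_holds`, ★ hom-lift
`ComplexTorus.exists_mapMatrix_of_mdifferentiable`.  HC_CM is proved only modulo the printed citations (2 remaining named inputs hLiu418 24832,
h413 24833) until rung 0 closes; this file is generic and changes no count.

THE MATHEMATICS.  Let `(Φ₀, ex₀)` be a relative exponential chart (★ `IsRelExpChartOn`) of the analytic projection `basePoint hT A φA : MA → MT`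
of an abelian scheme `A → T` over an open `U₀`, with (G): at every `t ∈ U₀` an additive analytification `φ_t : ComplexTorus (Φ₀ t) → A_t(ℂ)`
reading the fibre map `ex₀ (t, ·)`.  Let `ψ : ComplexTorus Ψ → A_{t₀}(ℂ)` be ANY second additive analytification of the fibre at `t₀ ∈ U₀`
(e.g. the torus map of an admissible marking).  By GAGA uniqueness (★ `IsAnalytification.unique_holds`, [SerreGAGA1956] §2 n°5 Prop. 2)
`φ_{t₀}⁻¹ ∘ ψ` is a biholomorphic, additive isomorphism of complex tori, hence (★ `ComplexTorus.exists_mapMatrix_of_mdifferentiable`,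
[LangeBirkenhake1992] Prop. 1.1.6) of the form `mapMatrix M₀` with a `ℂ`-linear analytic representation `L₀`: `Φ₀ t₀ ∘ M₀ = L₀ ∘ Ψ`,
`M₀ ∈ GL_{2g}(ℤ)`, `L₀` bijective.  Re-framing by the CONSTANT pair `(L₀, M₀)` (★ `IsRelExpChartOn.reframe`) gives the chart
`ex₁ (t, z) := ex₀ (t, L₀ z)`, `Φ₁ t := L₀⁻¹ ∘ Φ₀ t ∘ M₀`, still with (G) (★ `ComplexTorus.exists_homeomorph_of_baseChange` transports each `φ_t`),
and AT `t₀`: `Φ₁ t₀ = Ψ` and the fibre map of `ex₁` IS `ψ`.  In L7 (`stub_FLAT`): `ψ :=` the normal-form admissible marking of ★ ADM-NF at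
`s t₀`, so the (ADM)-package at `t₀` becomes a FRAME PACKAGE of `ex₁` — the base case from which flatness propagates admissibility along `U₀`.

* §1 `exists_intMatrix_clm_of_two_analytifications` — two additive torus analytifications of ONE abelian variety differ by `(M₀, L₀)`,
  `M₀` invertible over `ℤ`, `L₀` bijective `ℂ`-linear.
* §2 **`exists_normalisedChart`** — THE HEAD (generic abelian scheme `A → T`); `SiegelAdelicMarking.exists_normalisedChart` — the marking form.

## References
* [LangeBirkenhake1992] H. Lange, Ch. Birkenhake, *Complex Abelian Varieties* (1992), §1.1.2 Prop. 1.1.6 (analytic and rational representations).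
* [SerreGAGA1956] J.-P. Serre, *Géométrie algébrique et géométrie analytique*, Ann. Inst. Fourier 6 (1956), §2 n°5 Prop. 2 (unicité de `X^h`).
* [BirkenhakeLange2004] C. Birkenhake, H. Lange, *Complex Abelian Varieties*, 2nd ed. (2004), §8.7 (families of marked abelian varieties).
-/

set_option autoImplicit false

noncomputable section

open CategoryTheory CategoryTheory.Limits AlgebraicGeometry Matrix Topology Function
open scoped Manifold ContDiff
open Literature.AlgebraicGeometry.Motives (SchemeOver ComplexPoints AlgPoints AbelianVariety)
open Literature.AlgebraicGeometry.AbelianSchemes (AbelianSchemeOver)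
open Literature.Geometry.Kaehler (ComplexTorus toComplexLinear)
open Literature.Geometry.Kaehler.ComplexTorus (proj cover mapMatrix)
open Literature.Geometry.ComplexAnalytic (IsRelExpChartOn totalOver basePoint)
open Literature.NumberTheory.Transcendental (IsAnalytification)

namespace Literature.AlgebraicGeometry.ModuliOfAbelianVarieties

variable {g : ℕ}

/-! ### §1 Two additive torus analytifications of one abelian variety differ by an invertible integral matrix and a linear isomorphism -/

/-- Inverse integer matrices stay inverse after casting to `ℝ`. [folklore] -/
private theorem map_intCast_mul_eq_one' {P Q : Matrix (Fin g ⊕ Fin g) (Fin g ⊕ Fin g) ℤ} (h : P * Q = 1) :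
    P.map (Int.cast : ℤ → ℝ) * Q.map (Int.cast : ℤ → ℝ) = 1 := by
  have h1 : P.map (Int.cast : ℤ → ℝ) * Q.map (Int.cast : ℤ → ℝ) = (P * Q).map (Int.castRingHom ℝ) := by
    rw [Matrix.map_mul]; rfl
  rw [h1, h, Matrix.map_one _ (map_zero _) (map_one _)]

/-- **Two additive torus analytifications of ONE complex abelian variety differ by `(M₀, L₀)`**: for additive analytifications
`φ : ComplexTorus Φ → X(ℂ)` and `ψ : ComplexTorus Ψ → X(ℂ)` (charts on `ℂ^g`, `dim X = g`) there are mutually inverse integral matrices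
`M₀`, `M₀'` and a BIJECTIVE `ℂ`-linear `L₀` with `Φ ∘ M₀ = L₀ ∘ Ψ` and `ψ (π_Ψ z) = φ (π_Φ (L₀ z))` — GAGA uniqueness (★ `IsAnalytification.unique_holds`)
makes `φ⁻¹ ∘ ψ` a biholomorphic additive isomorphism of tori, and ★ `ComplexTorus.exists_mapMatrix_of_mdifferentiable` reads its rational and
analytic representations. [cite: SerreGAGA1956, §2 n°5 Prop. 2] [cite: LangeBirkenhake1992, §1.1.2 Prop. 1.1.6] -/
theorem exists_intMatrix_clm_of_two_analytifications (X : AbelianVariety ℂ) (hdim : X.dim = g)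
    {Φ Ψ : (Fin g ⊕ Fin g → ℝ) ≃L[ℝ] (Fin g → ℂ)}
    (φ : ComplexTorus Φ → X.Points ℂ) (hφ : IsAnalytification (Fin g → ℂ) X.X g φ) (hφadd : ∀ x y, φ (x + y) = φ x * φ y)
    (ψ : ComplexTorus Ψ → X.Points ℂ) (hψ : IsAnalytification (Fin g → ℂ) X.X g ψ) (hψadd : ∀ x y, ψ (x + y) = ψ x * ψ y) :
    ∃ (M₀ M₀' : Matrix (Fin g ⊕ Fin g) (Fin g ⊕ Fin g) ℤ) (L₀ : (Fin g → ℂ) →L[ℂ] (Fin g → ℂ)),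
      M₀ * M₀' = 1 ∧ M₀' * M₀ = 1 ∧ Bijective L₀ ∧
      (∀ x, Φ ((M₀.map (Int.cast : ℤ → ℝ)) *ᵥ x) = L₀ (Ψ x)) ∧
      ∀ z : Fin g → ℂ, ψ (cover Ψ z) = φ (cover Φ (L₀ z)) := by
  classical
  haveI : SmoothOfRelativeDimension g X.X.hom := hdim ▸ X.smoothOfRelativeDimension_dim
  -- GAGA uniqueness: `h = φ⁻¹ ∘ ψ` is a biholomorphism with `φ ∘ h = ψ`
  obtain ⟨h, hh, hhsymm, hcomp⟩ := IsAnalytification.unique_holds (E := Fin g → ℂ) (E' := Fin g → ℂ)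
    (M := ComplexTorus Ψ) (M' := ComplexTorus Φ) (X := X.X) (d := g) (φ := ψ) hψ hφ
  have hφh : ∀ x, φ (h x) = ψ x := fun x => congrFun hcomp x
  -- `h` is additive
  have hadd : ∀ x y, h (x + y) = h x + h y := by
    intro x y
    apply hφ.isHomeomorph.injective
    rw [hφh, hψadd, hφadd, hφh, hφh]
  have h0 : h 0 = 0 := by
    have h00 := hadd 0 0
    rw [add_zero] at h00
    exact left_eq_add.mp h00
  have h0' : h.symm 0 = 0 := by
    have h1 := h.symm_apply_apply 0
    rw [h0] at h1
    exact h1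
  -- rational and analytic representations of `h` and `h⁻¹`
  obtain ⟨M₀, L₀, hML, hhM⟩ :=
    ComplexTorus.exists_mapMatrix_of_mdifferentiable (Φ := Ψ) (Φ' := Φ) (F := h) hh
  obtain ⟨M₀', L₀', -, hhM'⟩ :=
    ComplexTorus.exists_mapMatrix_of_mdifferentiable (Φ := Φ) (Φ' := Ψ) (F := h.symm) hhsymm
  have hhM₀ : ∀ x, h x = mapMatrix Ψ Φ M₀ x := fun x => by rw [hhM, h0, add_zero]
  have hhM₀' : ∀ y, h.symm y = mapMatrix Φ Ψ M₀' y := fun y => by rw [hhM', h0', add_zero]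
  -- `M₀ M₀' = 1 = M₀' M₀` (the rational representation is faithful and multiplicative)
  have hMM' : M₀ * M₀' = 1 := by
    apply ComplexTorus.mapMatrix_injective (Φ := Φ) (Φ' := Φ)
    funext y
    show mapMatrix Φ Φ (M₀ * M₀') y = mapMatrix Φ Φ 1 y
    rw [← ComplexTorus.mapMatrix_mapMatrix (Φ' := Ψ), ← hhM₀', ← hhM₀, h.apply_symm_apply, ComplexTorus.mapMatrix_one]
  have hM'M : M₀' * M₀ = 1 := by
    apply ComplexTorus.mapMatrix_injective (Φ := Ψ) (Φ' := Ψ)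
    funext x
    show mapMatrix Ψ Ψ (M₀' * M₀) x = mapMatrix Ψ Ψ 1 x
    rw [← ComplexTorus.mapMatrix_mapMatrix (Φ' := Φ), ← hhM₀, ← hhM₀', h.symm_apply_apply, ComplexTorus.mapMatrix_one]
  -- `L₀ = Φ ∘ M₀ ∘ Ψ⁻¹` is bijective
  have hL₀ : ∀ u, L₀ u = Φ ((M₀.map (Int.cast : ℤ → ℝ)) *ᵥ Ψ.symm u) := fun u => by
    rw [hML, ContinuousLinearEquiv.apply_symm_apply]
  have hbij : Bijective L₀ := by
    have hM : Bijective fun x : Fin g ⊕ Fin g → ℝ => (M₀.map (Int.cast : ℤ → ℝ)) *ᵥ x := by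
      refine Function.bijective_iff_has_inverse.2 ⟨fun x => (M₀'.map (Int.cast : ℤ → ℝ)) *ᵥ x, fun x => ?_, fun x => ?_⟩
      · simp only [Matrix.mulVec_mulVec, map_intCast_mul_eq_one' hM'M, Matrix.one_mulVec]
      · simp only [Matrix.mulVec_mulVec, map_intCast_mul_eq_one' hMM', Matrix.one_mulVec]
    have hfun : (L₀ : (Fin g → ℂ) → (Fin g → ℂ)) = Φ ∘ (fun x => (M₀.map (Int.cast : ℤ → ℝ)) *ᵥ x) ∘ Ψ.symm :=
      funext hL₀
    rw [hfun]
    exact Φ.bijective.comp (hM.comp Ψ.symm.bijective)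
  refine ⟨M₀, M₀', L₀, hMM', hM'M, hbij, hML, fun z => ?_⟩
  rw [← hφh, hhM₀, ← ComplexTorus.cover_apply_eq_mapMatrix_cover hML]

/-! ### §2 THE HEAD: normalising a relative exponential chart at a point -/

/-- **NORM₀ — NORMALISING A RELATIVE EXPONENTIAL CHART AT A POINT.**  Let `(Φ₀, ex₀)` be a relative exponential chart of the analytic projection
`basePoint hT A φA : MA → MT` of an abelian scheme `A → T` over an open `U₀` (★ `IsRelExpChartOn`), with (G) on `U₀` (additive analytifications
`φ_t : ComplexTorus (Φ₀ t) → A_t(ℂ)` reading the fibre maps — the clause of ★ P-1 ∕ ★ P-3), and let `ψ : ComplexTorus Ψ → A_{t₀}(ℂ)` be any additive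
analytification of the fibre at a point `t₀ ∈ U₀` (`dim A_{t₀} = g`).  Then there is a relative exponential chart `(Φ₁, ex₁)` of the same
projection over `U₀`, again with (G), such that `Φ₁ t₀ = Ψ` and the fibre map of `ex₁` at `t₀` IS `ψ`:
`(φA (ex₁ (t₀, z))).left = fibrePointToLeft (ψ (π_Ψ z))`.  Construction: `ex₁ (t, z) := ex₀ (t, L₀ z)`, `Φ₁ t := L₀⁻¹ ∘ Φ₀ t ∘ M₀` with the
CONSTANT pair `(L₀, M₀)` of §1 comparing `φ_{t₀}` with `ψ` (★ `IsRelExpChartOn.reframe`; (G) transported fibrewise by ★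
`ComplexTorus.exists_homeomorph_of_baseChange` and ★ `IsAnalytification.comp_of_isHomeomorph`).  In L7 `ψ` is the normal-form admissible marking
of ★ ADM-NF at `s t₀`, and the conclusion makes the (ADM)-package at `t₀` a FRAME PACKAGE of `ex₁` (`m.Ψ = Φ₁ t₀`, torus map `=` fibre map).
[cite: LangeBirkenhake1992, §1.1.2 Prop. 1.1.6] [cite: SerreGAGA1956, §2 n°5 Prop. 2] [cite: BirkenhakeLange2004, §8.7] -/
theorem exists_normalisedChart {T : SchemeOver ℂ} {d : ℕ} (A : AbelianSchemeOver T.left)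
    {MT : Type} [TopologicalSpace MT] [ChartedSpace (Fin d → ℂ) MT]
    {φT : MT → ComplexPoints T} (hT : IsAnalytification (Fin d → ℂ) T d φT)
    {MA : Type} [TopologicalSpace MA] [ChartedSpace (Fin (d + g) → ℂ) MA]
    (φA : MA → ComplexPoints (totalOver T A))
    {U₀ : Set MT} {Φ₀ : MT → ((Fin g ⊕ Fin g → ℝ) ≃L[ℝ] (Fin g → ℂ))} {ex₀ : MT × (Fin g → ℂ) → MA}
    (hex₀ : IsRelExpChartOn (Fin d → ℂ) (Fin (d + g) → ℂ) (basePoint hT A φA) U₀ Φ₀ ex₀)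
    (hG₀ : ∀ t ∈ U₀, ∃ φt : ComplexTorus (Φ₀ t) → (A.fibre (φT t).left).toAbelianVariety.Points ℂ,
      IsAnalytification (Fin g → ℂ) (A.fibre (φT t).left).toAbelianVariety.X g φt ∧
      (∀ x y, φt (x + y) = φt x * φt y) ∧
      ∀ z : Fin g → ℂ, (φA (ex₀ (t, z))).left = A.fibrePointToLeft (φT t).left (φt (cover (Φ₀ t) z)))
    {t₀ : MT} (ht₀ : t₀ ∈ U₀) (hdim : (A.fibre (φT t₀).left).toAbelianVariety.dim = g)
    {Ψ : (Fin g ⊕ Fin g → ℝ) ≃L[ℝ] (Fin g → ℂ)} (ψ : ComplexTorus Ψ → (A.fibre (φT t₀).left).toAbelianVariety.Points ℂ)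
    (hψ : IsAnalytification (Fin g → ℂ) (A.fibre (φT t₀).left).toAbelianVariety.X g ψ) (hψadd : ∀ x y, ψ (x + y) = ψ x * ψ y) :
    ∃ (Φ₁ : MT → ((Fin g ⊕ Fin g → ℝ) ≃L[ℝ] (Fin g → ℂ))) (ex₁ : MT × (Fin g → ℂ) → MA),
      IsRelExpChartOn (Fin d → ℂ) (Fin (d + g) → ℂ) (basePoint hT A φA) U₀ Φ₁ ex₁ ∧
      (∀ t ∈ U₀, ∃ φt : ComplexTorus (Φ₁ t) → (A.fibre (φT t).left).toAbelianVariety.Points ℂ,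
        IsAnalytification (Fin g → ℂ) (A.fibre (φT t).left).toAbelianVariety.X g φt ∧
        (∀ x y, φt (x + y) = φt x * φt y) ∧
        ∀ z : Fin g → ℂ, (φA (ex₁ (t, z))).left = A.fibrePointToLeft (φT t).left (φt (cover (Φ₁ t) z))) ∧
      Φ₁ t₀ = Ψ ∧
      ∀ z : Fin g → ℂ, (φA (ex₁ (t₀, z))).left = A.fibrePointToLeft (φT t₀).left (ψ (cover Ψ z)) := by
  classical
  obtain ⟨φ₀, hφ₀, hadd₀, hjunc₀⟩ := hG₀ t₀ ht₀
  obtain ⟨M₀, M₀', L₀, hMM', hM'M, hbij, hML, hψφ⟩ :=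
    exists_intMatrix_clm_of_two_analytifications _ hdim φ₀ hφ₀ hadd₀ ψ hψ hψadd
  -- the constant frame change as continuous linear equivalences
  obtain ⟨eL, heL⟩ : ∃ e : (Fin g → ℂ) ≃L[ℂ] (Fin g → ℂ), (e : (Fin g → ℂ) →L[ℂ] (Fin g → ℂ)) = L₀ :=
    ⟨(LinearEquiv.ofBijective (L₀ : (Fin g → ℂ) →ₗ[ℂ] (Fin g → ℂ)) hbij).toContinuousLinearEquiv, by ext x; rfl⟩
  have heLapp : ∀ u, eL u = L₀ u := fun u => by rw [← heL]; rfl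
  let Lℝ : (Fin g → ℂ) ≃L[ℝ] (Fin g → ℂ) := eL.restrictScalars ℝ
  have hLℝ : ∀ u, Lℝ u = L₀ u := fun u => heLapp u
  let Mℝ : (Fin g ⊕ Fin g → ℝ) ≃L[ℝ] (Fin g ⊕ Fin g → ℝ) := LinearEquiv.toContinuousLinearEquiv
    { toFun := fun x => (M₀.map (Int.cast : ℤ → ℝ)) *ᵥ x
      invFun := fun x => (M₀'.map (Int.cast : ℤ → ℝ)) *ᵥ x
      map_add' := fun x y => Matrix.mulVec_add _ x y
      map_smul' := fun c x => Matrix.mulVec_smul _ c x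
      left_inv := fun x => by
        simp only [Matrix.mulVec_mulVec, map_intCast_mul_eq_one' hM'M, Matrix.one_mulVec]
      right_inv := fun x => by
        simp only [Matrix.mulVec_mulVec, map_intCast_mul_eq_one' hMM', Matrix.one_mulVec] }
  have hMℝ : ∀ x, Mℝ x = (M₀.map (Int.cast : ℤ → ℝ)) *ᵥ x := fun x => rfl
  -- the re-framed period family `Φ₁ t = L₀⁻¹ ∘ Φ₀ t ∘ M₀`
  let Φ₁ : MT → ((Fin g ⊕ Fin g → ℝ) ≃L[ℝ] (Fin g → ℂ)) := fun t => Mℝ.trans ((Φ₀ t).trans Lℝ.symm)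
  have hΦ₁ : ∀ t x, Φ₁ t x = Lℝ.symm (Φ₀ t ((M₀.map (Int.cast : ℤ → ℝ)) *ᵥ x)) := fun t x => rfl
  have hframe₀ : ∀ b x, Φ₀ b ((M₀.map (Int.cast : ℤ → ℝ)) *ᵥ x) = L₀ (Φ₁ b x) := by
    intro b x
    rw [hΦ₁, ← hLℝ, ContinuousLinearEquiv.apply_symm_apply]
  have hex₁ : IsRelExpChartOn (Fin d → ℂ) (Fin (d + g) → ℂ) (basePoint hT A φA) U₀ Φ₁
      (fun q : MT × (Fin g → ℂ) => ex₀ (q.1, L₀ q.2)) :=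
    hex₀.reframe (L := fun _ => L₀) mdifferentiableOn_const (fun _ _ => hbij) hMM' (fun b _ x => hframe₀ b x)
  have hLI : ∀ u, (Lℝ : (Fin g → ℂ) →L[ℝ] (Fin g → ℂ)) (Complex.I • u) =
      Complex.I • (Lℝ : (Fin g → ℂ) →L[ℝ] (Fin g → ℂ)) u := fun u => by
    show Lℝ (Complex.I • u) = Complex.I • Lℝ u
    rw [hLℝ, hLℝ, map_smul]
  refine ⟨Φ₁, fun q => ex₀ (q.1, L₀ q.2), hex₁, fun t ht => ?_, ?_, fun z => ?_⟩
  · -- (G) for the re-framed chart: transport `φ_t` along `mapMatrix M₀ : ComplexTorus (Φ₁ t) ≅ ComplexTorus (Φ₀ t)`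
    obtain ⟨φt, hφt, haddt, hjunct⟩ := hG₀ t ht
    obtain ⟨e, he, -, headd, hehol, -⟩ := ComplexTorus.exists_homeomorph_of_baseChange (Φ₁ t) (Φ₀ t) M₀ M₀' hMM' hM'M
      (Lℝ : (Fin g → ℂ) ≃L[ℝ] (Fin g → ℂ)) hLI (fun x => by rw [hframe₀, hLℝ])
    refine ⟨φt ∘ e, hφt.comp_of_isHomeomorph e.isHomeomorph (hehol.mdifferentiable (by simp)) rfl, fun x y => ?_, fun z => ?_⟩
    · show φt (e (x + y)) = φt (e x) * φt (e y)
      rw [headd, haddt]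
    · show (φA (ex₀ (t, L₀ z))).left = A.fibrePointToLeft (φT t).left (φt (e (cover (Φ₁ t) z)))
      rw [hjunct (L₀ z), he, ← ComplexTorus.cover_apply_eq_mapMatrix_cover (hframe₀ t)]
  · -- `Φ₁ t₀ = Ψ`
    ext x i
    rw [hΦ₁, hML, ← hLℝ, ContinuousLinearEquiv.symm_apply_apply]
  · -- the fibre map at `t₀` IS `ψ`
    show (φA (ex₀ (t₀, L₀ z))).left = A.fibrePointToLeft (φT t₀).left (ψ (cover Ψ z))
    rw [hjunc₀ (L₀ z), hψφ z]

/-- **NORM₀ for a marking**: the chart is re-framed so that AT `t₀` its period family is the marking's complex coordinate `m.Ψ` and its fibre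
map is the marking's torus map `m.toFun` — so every (ADM)-package `(m, Θ, Λ)` of `A` at `φT t₀` (★ `IsAdmissibleAt` read at the point, e.g. ★
ADM-NF `exists_admPackage_normalForm_of_junction`) IS a frame package of the re-framed chart at `t₀`.
[cite: LangeBirkenhake1992, §1.1.2 Prop. 1.1.6] [cite: SerreGAGA1956, §2 n°5 Prop. 2] [cite: BirkenhakeLange2004, §8.7] -/
theorem SiegelAdelicMarking.exists_normalisedChart {δ : Fin g → ℕ} {T : SchemeOver ℂ} {d : ℕ} (A : AbelianSchemeOver T.left)
    {MT : Type} [TopologicalSpace MT] [ChartedSpace (Fin d → ℂ) MT]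
    {φT : MT → ComplexPoints T} (hT : IsAnalytification (Fin d → ℂ) T d φT)
    {MA : Type} [TopologicalSpace MA] [ChartedSpace (Fin (d + g) → ℂ) MA]
    (φA : MA → ComplexPoints (totalOver T A))
    {U₀ : Set MT} {Φ₀ : MT → ((Fin g ⊕ Fin g → ℝ) ≃L[ℝ] (Fin g → ℂ))} {ex₀ : MT × (Fin g → ℂ) → MA}
    (hex₀ : IsRelExpChartOn (Fin d → ℂ) (Fin (d + g) → ℂ) (basePoint hT A φA) U₀ Φ₀ ex₀)
    (hG₀ : ∀ t ∈ U₀, ∃ φt : ComplexTorus (Φ₀ t) → (A.fibre (φT t).left).toAbelianVariety.Points ℂ,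
      IsAnalytification (Fin g → ℂ) (A.fibre (φT t).left).toAbelianVariety.X g φt ∧
      (∀ x y, φt (x + y) = φt x * φt y) ∧
      ∀ z : Fin g → ℂ, (φA (ex₀ (t, z))).left = A.fibrePointToLeft (φT t).left (φt (cover (Φ₀ t) z)))
    {t₀ : MT} (ht₀ : t₀ ∈ U₀) {J : C0pm δ} {a : gspFinAdelic δ}
    (m : SiegelAdelicMarking J a (A.fibre (φT t₀).left).toAbelianVariety) :
    ∃ (Φ₁ : MT → ((Fin g ⊕ Fin g → ℝ) ≃L[ℝ] (Fin g → ℂ))) (ex₁ : MT × (Fin g → ℂ) → MA),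
      IsRelExpChartOn (Fin d → ℂ) (Fin (d + g) → ℂ) (basePoint hT A φA) U₀ Φ₁ ex₁ ∧
      (∀ t ∈ U₀, ∃ φt : ComplexTorus (Φ₁ t) → (A.fibre (φT t).left).toAbelianVariety.Points ℂ,
        IsAnalytification (Fin g → ℂ) (A.fibre (φT t).left).toAbelianVariety.X g φt ∧
        (∀ x y, φt (x + y) = φt x * φt y) ∧
        ∀ z : Fin g → ℂ, (φA (ex₁ (t, z))).left = A.fibrePointToLeft (φT t).left (φt (cover (Φ₁ t) z))) ∧
      Φ₁ t₀ = m.Ψ ∧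
      ∀ z : Fin g → ℂ, (φA (ex₁ (t₀, z))).left = A.fibrePointToLeft (φT t₀).left (m.toFun (cover m.Ψ z)) := by
  have han : IsAnalytification (Fin g → ℂ) (A.fibre (φT t₀).left).toAbelianVariety.X g m.toFun := by
    have h := m.isAnalytification
    rwa [m.dim_eq] at h
  exact Literature.AlgebraicGeometry.ModuliOfAbelianVarieties.exists_normalisedChart A hT φA hex₀ hG₀ ht₀ m.dim_eq m.toFun han
    m.toFun_add

end Literature.AlgebraicGeometry.ModuliOfAbelianVarieties

end
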